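import Summits.QuantumFields.BalabanUV.T4Continuum.Support.VariationalCovariantTwoRunsSocket
import Summits.QuantumFields.BalabanUV.T4Continuum.Support.VariationalCovariantEndLocal

/-!
# T⁴ programme, spine node NE2 (U1a), lane P2 — SUPPLIER ITEM (O2′), file 3: THE FRAME-FREE TWO-RUNS END WITH ITS TWO-RUN CLASS DISCHARGED
# FROM NODE U1b's `LocalRate` — the road owner's `VariationalCovariantEndLocal.towerLimitRate_twoRuns_closed_local` (p215541) plugged exactly
# as file 2 plugs the framed END

NE2 formalisation swarm `b2b-balaban-t4-ne2-formalise-*`, leaf prover 09 (gen 5); register row «P2-sup»; the road owner `b2b-balaban-t4-ne2-p2`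
gen 11's GO (journal CLAIMS.log 2026-08-20T10:52:21Z, (iv) «please target BOTH sockets if cheap: `towerLimitRate_twoRuns_closed` (p215328, ten
frame binders displayed) AND the frame-free `VariationalCovariantEndLocal.towerLimitRate_twoRuns_closed_local` (p215541; `hd : 1 ≤ d`, `habsorb :
64d(n m)² ≤ ½`, `hsmall`, `hsmall₁` in place of the frames) — the latter is the one leaf-04-g3's taxi discharges inhabit without residual displayed
binders»).  Inputs BY NAME: file 2 `VariationalCovariantTwoRunsSocket` (`cRho`, `rho`, `tau`, `lev_mul_rho`, `rho_nonneg`, `tau_nonneg`, `tau_le`,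
`norm_coarse_sub_le_of_localRate`, `norm_nest_sub_nest_le_of_localRate`), file 1 `VariationalCovariantTwoRunsTransport` (`nestOf`, `norm_nestOf`,
`nestOf_succ_tower`), leaf-09-g4's `fineOf ∕ Rtr_fineOf ∕ towReadings`, the owner's `towerLimitRate_twoRuns_closed_local`, leaf-04-g2's `taxiT ∕ coarseT`.
 * **`towerLimitRate_twoRuns_of_localRate_local`** — p215541 for data `(Rc, Rb, T, Tb, R′, T′)` given by the five presentation equations
   (`R′ k = fineOf Rc k`, `Rb k = coarseT (R′ k)`, `T k = nestOf k (Rc k)`, `Tb k = nestOf k (Rb k)`, `T′ k = taxiT (R′ k)`), with unit modulus,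
   COMP⁺, `hRtr` and the TWO-RUN CLASS (`hθ0 hθ1 hρ0 hρ hρc hτ0 hτ hτc`, rate `max θ L⁻¹`, `c_ρ = 2C + (α²∕2)e^α`, `c_τ = d·c_ρ`) DISCHARGED from
   `LocalRate (towReadings L M 𝒟) C θ` + `Rc ∈ 𝒟` + the size class; the frame-free binders of p215541 (run-`k` UB⁺∕P⁺ in leaf shape, `hmis` with
   `64d(n m)² ≤ ½`, reference transports `Tb₀` with `hwin ∕ hrel ∕ hsmall ∕ hw′`, `hP`, `hin ∕ hcross ∕ hsmall₁`, the pair's CLASS, `1 ≤ d`) DISPLAYED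
   VERBATIM;
 * **`towerLimitRate_twoRuns_of_localRate_local_nest`** — the canonical instance (the five equations by `rfl`).
WHAT IS NOT HERE (stated, not hidden): any discharge of `LocalRate` (node NE3 ∕ U1b OPEN, DISPLAYED); the displayed binders at taxi data
((O7) ∕ (O10) through file 1's bridge `nestT_succ_eq_nestOf`); no B0.

HONEST FRAMING (T4-DAG p. 1).  Bookkeeping (compositions BY NAME), [folklore]; model level (U(1) charged-scalar sector of road P2; phases ∕
taxi contours ∕ defects = DATA); nothing printed is a hypothesis; no `def`; no `def … : Prop`; no `sorry`; axioms standard.  NE3 OPEN; NE2 NOT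
proved; spine PROVED 0∕9 unchanged; rung (B)+1 finite T⁴ — NOT infinite volume, NOT a mass gap, NOT Clay.  HONEST DEPENDENCY (cell, verbatim):
continuum YM on T⁴ ⇐ BetaPertH ∧ nine spine estimates (0/9 proved); BetaPertH ⇐ (D1) ∧ (D4) ∧ CAP+tail; G-an2-4 gates asym, D1 and NE2/3/4.
-/

noncomputable section

open scoped Matrix ComplexConjugate ComplexOrder Matrix.Norms.L2Operator BigOperators

namespace Summit.QuantumFields.BalabanUV.T4Continuum.VariationalCovariantTwoRunsSocketLocal

open Literature.MathematicalPhysics.QuantumFieldTheory.Balaban1983to89.B5Prop11Plancherel (Tor fine unitVec)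
open Literature.MathematicalPhysics.QuantumFieldTheory.Balaban1983to89.B5Prop11Lower (nsq)
open Literature.MathematicalPhysics.QuantumFieldTheory.Balaban1983to89.B5Block118 (bpt)
open Literature.MathematicalPhysics.QuantumFieldTheory.Balaban1983to89.T4EtaRateMin (LocalRate)
open Summit.QuantumFields.BalabanUV.T4Continuum.VariationalCovariantEffective (effSc)
open Summit.QuantumFields.BalabanUV.T4Continuum.VariationalCovariantTower (compT Rtr)
open Summit.QuantumFields.BalabanUV.T4Continuum.VariationalCovariantFederbush (mis)
open Summit.QuantumFields.BalabanUV.T4Continuum.VariationalCovariantScalarPair (Sc qW Qk)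
open Summit.QuantumFields.BalabanUV.T4Continuum.VariationalCovariantEnd (lamC)
open Summit.QuantumFields.BalabanUV.T4Continuum.VariationalCovariantTwoRuns (towReadings)
open Summit.QuantumFields.BalabanUV.T4Continuum.VariationalCovariantTwoRunsNE3 (fineOf Rtr_fineOf)
open Summit.QuantumFields.BalabanUV.T4Continuum.VariationalCovariantTwoRunsEnd (cTwoRuns)
open Summit.QuantumFields.BalabanUV.T4Continuum.VariationalCovariantEndLocal (towerLimitRate_twoRuns_closed_local)
open Summit.QuantumFields.BalabanUV.T4Continuum.VariationalCovariantTwoRunsTransport (nestOf norm_nestOf nestOf_succ_tower)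
open Summit.QuantumFields.BalabanUV.T4Continuum.VariationalCovariantTwoRunsSocket
  (cRho rho tau lev_mul_rho rho_nonneg tau_nonneg tau_le norm_coarse_sub_le_of_localRate norm_nest_sub_nest_le_of_localRate)
open Summit.QuantumFields.BalabanUV.T4Continuum.CovariantAveragingTower (TowerLimitRate)
open Summit.QuantumFields.BalabanUV.T4Continuum.VariationalTaxiTransport (taxiT norm_taxiT)
open Summit.QuantumFields.BalabanUV.T4Continuum.VariationalTaxiCoarse (coarseT norm_coarseT)

variable {d : ℕ} (L : ℕ) [NeZero L] (M : Fin d → ℕ) [hM : ∀ μ, NeZero (M μ)]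

section EndLocal

variable (Rc Rb : (k : ℕ) → Tor (fine (L ^ k) M) → Fin d → ℂ) (T Tb Tb₀ : (k : ℕ) → Tor (fine (L ^ k) M) → ℂ)
variable (R' : (k : ℕ) → Tor (fine L (fine (L ^ k) M)) → Fin d → ℂ) (T' : (k : ℕ) → Tor (fine L (fine (L ^ k) M)) → ℂ)
variable (m w w' a m₁ : ℕ → ℝ)

/-- **THE FRAME-FREE TWO-RUNS END WITH THE TWO-RUN CLASS DISCHARGED FROM NODE U1b's `LocalRate` (P2, scalar covariant species, model level).**
The road owner's `towerLimitRate_twoRuns_closed_local` (p215541) for a tower of runs `Rc ∈ 𝒟` (unit phases, size class `α`) on whose class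
`LocalRate (towReadings L M 𝒟) C θ` holds (DISPLAYED), the two runs' objects being the contour system applied to their own phases (five presentation
equations; `rfl` for the canonical choice).  DISCHARGED: unit modulus of `T∕Tb∕Rb∕R′∕T′`, COMP⁺, `hRtr`, the TWO-RUN CLASS (`c_ρ = 2C + (α²∕2)e^α`,
`c_τ = d·c_ρ`, rate `max θ L⁻¹`).  DISPLAYED VERBATIM (p215541's letters): `1 ≤ d`, run-`k` UB⁺∕P⁺ in leaf shape, the mismatch `m` with
`64d(n m)² ≤ ½`, reference transports `Tb₀` (`hwin`, `hrel ≤ γ < 1`, `2d(n w)² + 4γ² ≤ ½`, `hw′`), plaquette defect `a`, one-step defects `m₁`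
(`hin`, `hcross`, `2d(L m₁)² ≤ ½`), the pair's CLASS.  NE3 NOT discharged; NE2 NOT proved. [folklore] -/
theorem towerLimitRate_twoRuns_of_localRate_local (hd : 1 ≤ d) (hL : 2 ≤ L)
    {𝒟 : Set ((k : ℕ) → Tor (fine (L ^ k) M) → Fin d → ℂ)} {C θ α : ℝ} (hC : 0 ≤ C) (hθ0 : 0 ≤ θ) (hθ1 : θ < 1) (hα : 0 ≤ α)
    (hNE3 : LocalRate (towReadings L M 𝒟) C θ) (hRc𝒟 : Rc ∈ 𝒟)
    (hRc1 : ∀ k x μ, ‖Rc k x μ‖ = 1) (hsize : ∀ k x μ, ‖((L ^ k : ℕ) : ℂ) * (Rc k x μ - 1)‖ ≤ α)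
    (hR'def : ∀ k, R' k = fineOf L M Rc k) (hRbdef : ∀ k, Rb k = coarseT L (fine (L ^ k) M) (R' k))
    (hTdef : ∀ k, T k = nestOf L M k (Rc k)) (hTbdef : ∀ k, Tb k = nestOf L M k (Rb k))
    (hT'def : ∀ k, T' k = taxiT L (fine (L ^ k) M) (R' k))
    (hUBk : ∀ k (μ : Tor M → ℂ), ∃ f, Qk (L ^ k) M (T k) f = μ ∧
      Sc (L ^ k) M (Rc k) f ≤ lamC d ((((L ^ k : ℕ)) : ℝ) * w' k) * nsq μ)
    (hPk : ∀ k f, qW (L ^ k) M f ≤ (1088 * (d : ℝ) + 128) * (Sc (L ^ k) M (Rc k) f + nsq (Qk (L ^ k) M (T k) f)))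
    (hm : ∀ k, 0 ≤ m k) (hmis : ∀ k y μ j, ‖mis L (fine (L ^ k) M) (Rb k) (R' k) (T' k) y μ j‖ ≤ m k)
    (habsorb : ∀ k, 64 * (d : ℝ) * ((((L ^ k : ℕ)) : ℝ) * m k) ^ 2 ≤ 1 / 2)
    (hTb₀ : ∀ k x, ‖Tb₀ k x‖ = 1) (hw : ∀ k, 0 ≤ w k)
    (hwin : ∀ k (y : Tor M) (j : Fin d → Fin (L ^ k)) (μ : Fin d), (j μ : ℕ) + 1 < L ^ k →
      ‖Rb k (bpt (L ^ k) M y j) μ * (starRingEnd ℂ) (Tb₀ k (bpt (L ^ k) M y j + unitVec (fine (L ^ k) M) μ)) * Tb₀ k (bpt (L ^ k) M y j) - 1‖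
        ≤ w k)
    {γ : ℝ} (hγ : γ < 1) (hrel : ∀ k x, ‖Tb k x * (starRingEnd ℂ) (Tb₀ k x) - 1‖ ≤ γ)
    (hsmall : ∀ k, 2 * (d : ℝ) * ((((L ^ k : ℕ)) : ℝ) * w k) ^ 2 + 4 * γ ^ 2 ≤ 1 / 2)
    (hw'0 : ∀ k, 0 ≤ w' k) (hw' : ∀ k, (4 + (((L ^ k : ℕ)) : ℝ) * w k) / (1 - γ) - 1 ≤ (((L ^ k : ℕ)) : ℝ) * w' k)
    (ha : ∀ k, 0 ≤ a k)
    (hP : ∀ k x μ ν, ‖Rb k x μ * Rb k (x + unitVec (fine (L ^ k) M) μ) ν - Rb k x ν * Rb k (x + unitVec (fine (L ^ k) M) ν) μ‖ ≤ a k)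
    (hm₁ : ∀ k, 0 ≤ m₁ k)
    (hin : ∀ k (y : Tor (fine (L ^ k) M)) (j : Fin d → Fin L) (μ : Fin d), (j μ : ℕ) + 1 < L →
      ‖R' k (bpt L (fine (L ^ k) M) y j) μ * (starRingEnd ℂ) (T' k (bpt L (fine (L ^ k) M) y j + unitVec (fine L (fine (L ^ k) M)) μ))
          * T' k (bpt L (fine (L ^ k) M) y j) - 1‖ ≤ m₁ k)
    (hcross : ∀ k (y : Tor (fine (L ^ k) M)) (j : Fin d → Fin L) (μ : Fin d), (j μ : ℕ) + 1 = L →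
      ‖R' k (bpt L (fine (L ^ k) M) y j) μ * (starRingEnd ℂ) (T' k (bpt L (fine (L ^ k) M) y j + unitVec (fine L (fine (L ^ k) M)) μ))
          * T' k (bpt L (fine (L ^ k) M) y j) - Rb k y μ‖ ≤ m₁ k)
    (hsmall₁ : ∀ k, 2 * (d : ℝ) * ((L : ℝ) * m₁ k) ^ 2 ≤ 1 / 2)
    {cw ca cm c₁ : ℝ}
    (hwc : ∀ k, (((L ^ k : ℕ)) : ℝ) * w' k ≤ cw) (hac : ∀ k, a k * (((L ^ k : ℕ)) : ℝ) ^ 2 ≤ ca)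
    (hmc : ∀ k, (((L ^ k : ℕ)) : ℝ) ^ 2 * m k ≤ cm) (hm₁c : ∀ k, (((L ^ k : ℕ)) : ℝ) ^ 2 * m₁ k ≤ c₁)
    {a₀ : ℝ} (ha₀ : 0 < a₀) :
    TowerLimitRate (ι := fun _ => Tor M) (fun _ => (1 : Matrix (Tor M) (Tor M) ℂ)) 1
      (fun k => effSc (L ^ k) M (Rc k) (T k) a₀) (cTwoRuns d L cw ca cm c₁ (cRho C α) ((d : ℝ) * cRho C α)) (max θ (L : ℝ)⁻¹) := by
  have hL2 : (2 : ℝ) ≤ L := by exact_mod_cast hL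
  have hLinv1 : (L : ℝ)⁻¹ < 1 := inv_lt_one_of_one_lt₀ (by linarith)
  have hθ'0 : 0 ≤ max θ (L : ℝ)⁻¹ := le_max_of_le_left hθ0
  have hθ'1 : max θ (L : ℝ)⁻¹ < 1 := max_lt hθ1 hLinv1
  have hR'1 : ∀ k x μ, ‖R' k x μ‖ = 1 := fun k x μ => by rw [hR'def k]; exact hRc1 (k + 1) _ μ
  have hRb1 : ∀ k y μ, ‖Rb k y μ‖ = 1 := fun k y μ => by rw [hRbdef k]; exact norm_coarseT L (fine (L ^ k) M) (hR'1 k) y μ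
  have hT1 : ∀ k x, ‖T k x‖ = 1 := fun k x => by rw [hTdef k]; exact norm_nestOf L M k (hRc1 k) x
  have hTb1 : ∀ k x, ‖Tb k x‖ = 1 := fun k x => by rw [hTbdef k]; exact norm_nestOf L M k (hRb1 k) x
  have hT'1 : ∀ k x, ‖T' k x‖ = 1 := fun k x => by rw [hT'def k]; exact norm_taxiT L (fine (L ^ k) M) (hR'1 k) x
  have hTcomp : ∀ k, T (k + 1) = compT (L ^ k) L M (Tb k) (T' k) := fun k => by
    rw [hTdef (k + 1), hTbdef k, hT'def k, hRbdef k, hR'def k]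
    exact nestOf_succ_tower L M Rc k
  have hRtr : ∀ k, Rc (k + 1) = Rtr (L ^ k) L M (R' k) := fun k => by rw [hR'def k, Rtr_fineOf]
  have hρ : ∀ k y μ, ‖Rb k y μ - Rc k y μ‖ ≤ rho L C θ α k := fun k y μ => by
    rw [hRbdef k, hR'def k]; exact norm_coarse_sub_le_of_localRate L M hC hθ0 hα hNE3 hRc𝒟 hsize k y μ
  have hτ : ∀ k x, ‖Tb k x - T k x‖ ≤ tau d L C θ α k := fun k x => by
    rw [hTbdef k, hTdef k, hRbdef k, hR'def k]
    exact norm_nest_sub_nest_le_of_localRate L M hC hθ0 hα hNE3 hRc𝒟 hRc1 hsize k x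
  have key := towerLimitRate_twoRuns_closed_local L M Rc Rb T Tb Tb₀ R' T' m w w' a m₁ (rho L C θ α) (tau d L C θ α) hd hL hT1 hUBk hPk
    hTb1 hRb1 (fun k x μ => (hR'1 k x μ).le) hT'1 hTcomp hRtr hm hmis habsorb hTb₀ hw hwin hγ hrel hsmall hw'0 hw' ha hP hm₁ hin hcross
    hsmall₁ hwc hac hmc hm₁c hθ'0 hθ'1 (rho_nonneg L hC hθ0 α) hρ (fun k => (lev_mul_rho L C θ α k).le)
    (tau_nonneg (d := d) L hC hθ0 α) hτ (fun k => tau_le (d := d) L hC hθ0 α k) ha₀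
  have e : max ((L : ℝ)⁻¹) (max θ (L : ℝ)⁻¹) = max θ (L : ℝ)⁻¹ := by
    rw [← max_assoc, max_comm ((L : ℝ)⁻¹) θ, max_assoc, max_self]
  rw [e] at key
  exact key

/-- **THE CANONICAL INSTANCE** of the frame-free END (the five presentation equations by `rfl`). [folklore] -/
theorem towerLimitRate_twoRuns_of_localRate_local_nest (hd : 1 ≤ d) (hL : 2 ≤ L)
    {𝒟 : Set ((k : ℕ) → Tor (fine (L ^ k) M) → Fin d → ℂ)} {C θ α : ℝ} (hC : 0 ≤ C) (hθ0 : 0 ≤ θ) (hθ1 : θ < 1) (hα : 0 ≤ α)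
    (hNE3 : LocalRate (towReadings L M 𝒟) C θ) (hRc𝒟 : Rc ∈ 𝒟)
    (hRc1 : ∀ k x μ, ‖Rc k x μ‖ = 1) (hsize : ∀ k x μ, ‖((L ^ k : ℕ) : ℂ) * (Rc k x μ - 1)‖ ≤ α)
    (hUBk : ∀ k (μ : Tor M → ℂ), ∃ f, Qk (L ^ k) M (nestOf L M k (Rc k)) f = μ ∧
      Sc (L ^ k) M (Rc k) f ≤ lamC d ((((L ^ k : ℕ)) : ℝ) * w' k) * nsq μ)
    (hPk : ∀ k f, qW (L ^ k) M f ≤ (1088 * (d : ℝ) + 128) * (Sc (L ^ k) M (Rc k) f + nsq (Qk (L ^ k) M (nestOf L M k (Rc k)) f)))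
    (hm : ∀ k, 0 ≤ m k)
    (hmis : ∀ k y μ j, ‖mis L (fine (L ^ k) M) (coarseT L (fine (L ^ k) M) (fineOf L M Rc k)) (fineOf L M Rc k)
      (taxiT L (fine (L ^ k) M) (fineOf L M Rc k)) y μ j‖ ≤ m k)
    (habsorb : ∀ k, 64 * (d : ℝ) * ((((L ^ k : ℕ)) : ℝ) * m k) ^ 2 ≤ 1 / 2)
    (hTb₀ : ∀ k x, ‖Tb₀ k x‖ = 1) (hw : ∀ k, 0 ≤ w k)
    (hwin : ∀ k (y : Tor M) (j : Fin d → Fin (L ^ k)) (μ : Fin d), (j μ : ℕ) + 1 < L ^ k →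
      ‖coarseT L (fine (L ^ k) M) (fineOf L M Rc k) (bpt (L ^ k) M y j) μ
          * (starRingEnd ℂ) (Tb₀ k (bpt (L ^ k) M y j + unitVec (fine (L ^ k) M) μ)) * Tb₀ k (bpt (L ^ k) M y j) - 1‖ ≤ w k)
    {γ : ℝ} (hγ : γ < 1)
    (hrel : ∀ k x, ‖nestOf L M k (coarseT L (fine (L ^ k) M) (fineOf L M Rc k)) x * (starRingEnd ℂ) (Tb₀ k x) - 1‖ ≤ γ)
    (hsmall : ∀ k, 2 * (d : ℝ) * ((((L ^ k : ℕ)) : ℝ) * w k) ^ 2 + 4 * γ ^ 2 ≤ 1 / 2)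
    (hw'0 : ∀ k, 0 ≤ w' k) (hw' : ∀ k, (4 + (((L ^ k : ℕ)) : ℝ) * w k) / (1 - γ) - 1 ≤ (((L ^ k : ℕ)) : ℝ) * w' k)
    (ha : ∀ k, 0 ≤ a k)
    (hP : ∀ k x μ ν, ‖coarseT L (fine (L ^ k) M) (fineOf L M Rc k) x μ
        * coarseT L (fine (L ^ k) M) (fineOf L M Rc k) (x + unitVec (fine (L ^ k) M) μ) ν
      - coarseT L (fine (L ^ k) M) (fineOf L M Rc k) x ν
        * coarseT L (fine (L ^ k) M) (fineOf L M Rc k) (x + unitVec (fine (L ^ k) M) ν) μ‖ ≤ a k)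
    (hm₁ : ∀ k, 0 ≤ m₁ k)
    (hin : ∀ k (y : Tor (fine (L ^ k) M)) (j : Fin d → Fin L) (μ : Fin d), (j μ : ℕ) + 1 < L →
      ‖fineOf L M Rc k (bpt L (fine (L ^ k) M) y j) μ
          * (starRingEnd ℂ) (taxiT L (fine (L ^ k) M) (fineOf L M Rc k) (bpt L (fine (L ^ k) M) y j + unitVec (fine L (fine (L ^ k) M)) μ))
          * taxiT L (fine (L ^ k) M) (fineOf L M Rc k) (bpt L (fine (L ^ k) M) y j) - 1‖ ≤ m₁ k)
    (hcross : ∀ k (y : Tor (fine (L ^ k) M)) (j : Fin d → Fin L) (μ : Fin d), (j μ : ℕ) + 1 = L →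
      ‖fineOf L M Rc k (bpt L (fine (L ^ k) M) y j) μ
          * (starRingEnd ℂ) (taxiT L (fine (L ^ k) M) (fineOf L M Rc k) (bpt L (fine (L ^ k) M) y j + unitVec (fine L (fine (L ^ k) M)) μ))
          * taxiT L (fine (L ^ k) M) (fineOf L M Rc k) (bpt L (fine (L ^ k) M) y j)
        - coarseT L (fine (L ^ k) M) (fineOf L M Rc k) y μ‖ ≤ m₁ k)
    (hsmall₁ : ∀ k, 2 * (d : ℝ) * ((L : ℝ) * m₁ k) ^ 2 ≤ 1 / 2)
    {cw ca cm c₁ : ℝ}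
    (hwc : ∀ k, (((L ^ k : ℕ)) : ℝ) * w' k ≤ cw) (hac : ∀ k, a k * (((L ^ k : ℕ)) : ℝ) ^ 2 ≤ ca)
    (hmc : ∀ k, (((L ^ k : ℕ)) : ℝ) ^ 2 * m k ≤ cm) (hm₁c : ∀ k, (((L ^ k : ℕ)) : ℝ) ^ 2 * m₁ k ≤ c₁)
    {a₀ : ℝ} (ha₀ : 0 < a₀) :
    TowerLimitRate (ι := fun _ => Tor M) (fun _ => (1 : Matrix (Tor M) (Tor M) ℂ)) 1
      (fun k => effSc (L ^ k) M (Rc k) (nestOf L M k (Rc k)) a₀) (cTwoRuns d L cw ca cm c₁ (cRho C α) ((d : ℝ) * cRho C α))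
      (max θ (L : ℝ)⁻¹) :=
  towerLimitRate_twoRuns_of_localRate_local L M Rc (fun k => coarseT L (fine (L ^ k) M) (fineOf L M Rc k)) (fun k => nestOf L M k (Rc k))
    (fun k => nestOf L M k (coarseT L (fine (L ^ k) M) (fineOf L M Rc k))) Tb₀ (fun k => fineOf L M Rc k)
    (fun k => taxiT L (fine (L ^ k) M) (fineOf L M Rc k)) m w w' a m₁ hd hL hC hθ0 hθ1 hα hNE3 hRc𝒟 hRc1 hsize
    (fun _ => rfl) (fun _ => rfl) (fun _ => rfl) (fun _ => rfl) (fun _ => rfl) hUBk hPk hm hmis habsorb hTb₀ hw hwin hγ hrel hsmall hw'0 hw'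
    ha hP hm₁ hin hcross hsmall₁ hwc hac hmc hm₁c ha₀

end EndLocal

end Summit.QuantumFields.BalabanUV.T4Continuum.VariationalCovariantTwoRunsSocketLocal

end
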